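import Summits.QuantumAdvantage.AdviceFreeQNC0.PerOutputFormsFibre39
import Summits.QuantumAdvantage.AdviceFreeQNC0.LinJunta39
import Summits.QuantumAdvantage.AdviceFreeQNC0.GradedSeeds38JuntaReduction
import Summits.QuantumAdvantage.AdviceFreeQNC0.DWalkOneBell
import HarnessLib

/-!
# Cell qa-qnc0, `p = 3` — (J3) `BlockFibre37.PerOutputFormsHardConst` is FRAME- and CHARGE-INDEPENDENT:
# the walk-frame conjecture at EVERY charge `c` is equivalent to its x-frame form on the odd class (= the single charge `n + 2`)
# (prover qn-prover-3 g28; closes the «general charge» gap recorded in `SeedJuntaSlack39Walk` / PROVER3-MEMO-gen27 §3 (2); part 2, sequel of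
# `PerOutputFormsFibre39`)

(J3) (`BlockCombJoin37`, planner qa-qnc0-p1 g37) asks, in WALK coordinates `u : Fin n → Bool` and for EVERY charge `c`, that a strategy whose
output `g` is an arbitrary table `F g` of its own `r` dense `𝔽₃`-forms `gateSum (ℓ g i) u` wins `ringWinU c` on `≤ θ·2ⁿ` inputs.  Every x-frame theorem
of the cell (Theorem G, the structured branch `GradedSeeds38.perOutputForms_structured_slackX'`, the dichotomy `perOutputForms_dichotomy`, …) is a
statement about `#{x odd : RingHLF.Rel x (k ↦ tGuess x k ⊕ F k (linVal (ℓ k i) x)_i)}`, which transports to the walk frame at the SINGLE charge `n + 2`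
(`rel_iff_ringWinU`).  This file proves that nothing is lost:

* ★ `formsFibre_eq` — CLASS CLOSURE: on the suffix fibre `{glue3 a w b}` (last three walk bits fixed) the (J3)-strategy with `r` forms per output IS
  a (J3)-strategy of the window game with `r' = #(Fin r ⊕ (Fin 3 × Fin r) ⊕ Unit) = 4r + 1` forms per output (own restricted forms, the three outside
  outputs' restricted forms through which the even outside triple is read, and `e₀` for the bit `w₀ = ¬x'₀` of E4's row `0`), at charge `c + |b|`
  (`ringWinU_glue3_eq_mixedWinU` + `ringWinU_tripleRows` + `gateSum_glue3_suffix` + `ringWinU_xor`);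
* `card_forms_le_of_topCharge` — hardness of (J3)-strategies (`4r + 1` forms) at the charges `≡ n + 2` on `n` bits bounds every (J3)-strategy
  (`r` forms) at EVERY charge on `n + 3` bits by `(6 + 2θ)·2ⁿ` (two of the eight suffixes are good: `two_le_card_charge_class`);
* ★ `perOutputFormsHardConst_of_topCharge` — (J3) at the single charge `n + 2` (all large `n`, all `r`) ⟹ (J3), with `θ' = (3 + θ)/4`;
* ★ `topCharge_of_xframe`, `perOutputFormsHardConst_of_xframe`, `xframe_of_perOutputFormsHardConst`, ★★ **`perOutputFormsHardConst_iff_xframe`**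
  — (J3) ⟺ its x-frame form `∃ θ < 1, ∀ r, ∃ n₀, ∀ N ≥ n₀, ∀ ℓ F, #{x : OddZeros x ∧ Rel x (k ↦ tGuess x k ⊕ F k (linVal (ℓ k i) x)_i)} ≤ θ·2^{N−1}`
  (the format of `perOutputForms_structured_slackX'` / `perOutputForms_dichotomy` with `W`, seeds and remainders forgotten; transports
  `GradedSeeds38.card_filter_le_card_odd`, `card_odd_filter_le`).

So the planners may work on (J3) purely in the x-frame / on the odd class: the `∀ c` of the typed conjecture is automatic, at the cost of the
constant `(3 + θ)/4` and of `3r + 1` extra forms per output inside the proof (absorbed by `∀ r`).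

WHAT THIS IS NOT: (J3) itself is not proved (OPEN); (J2) `PerOutputGatesHardConst` (walk windows) is not treated (suffix peeling moves the outside
triple to rows `0, 1`, far from the outside outputs' windows — it needs prefix peeling); crux `stmt-QuantumAdvantage-22907` untouched; no ledger
item (D-0168 shelf).
-/

noncomputable section

namespace Summit.QuantumAdvantage.AdviceFreeQNC0

open Classical
open Finset
open Literature.Computability.QuantumComplexity Literature.Computability.QuantumComplexity.RingHLF
open Literature.Computability.MetaComplexity

namespace BlockFibre37

/-! ### §3 Class closure: the fibre strategy is a (J3)-strategy of the window game with `4r + 1` forms -/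

variable {n : ℕ}

/-- The first window bit as a form value: `gateSum e₀ w = [x'_0] = [¬w₀]`. -/
theorem gateSum_e0 (hn : 1 ≤ n) (w : Fin n → Bool) :
    gateSum (fun m : Fin (n + 1) => if m.val = 0 then (1 : ZMod 3) else 0) w =
      if w ⟨0, hn⟩ = true then 0 else 1 := by
  unfold gateSum
  rw [Finset.sum_eq_single (⟨0, by omega⟩ : Fin (n + 1))]
  · have hu : uExt w 0 = w ⟨0, hn⟩ := by unfold uExt; rw [dif_pos (show 0 < n by omega)]
    have hx : xOfU w ⟨0, by omega⟩ = !(w ⟨0, hn⟩) := by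
      show (!(xor (uExt w 0) (if (0 : ℕ) = 0 then false else uExt w (0 - 1)))) = !(w ⟨0, hn⟩)
      rw [if_pos rfl, hu, Bool.xor_false]
    rw [hx]
    beta_reduce
    cases w ⟨0, hn⟩ <;> simp
  · intro m _ hm
    have : m.val ≠ 0 := fun h => hm (Fin.ext h)
    beta_reduce
    simp [this]
  · intro h; exact absurd (Finset.mem_univ _) h

/-- Hence `w₀ = [gateSum e₀ w = 0]`. -/
theorem decide_gateSum_e0 (hn : 1 ≤ n) (w : Fin n → Bool) :
    decide (gateSum (fun m : Fin (n + 1) => if m.val = 0 then (1 : ZMod 3) else 0) w = 0) = w ⟨0, hn⟩ := by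
  rw [gateSum_e0 hn]
  cases w ⟨0, hn⟩ <;> decide

/-- **CLASS CLOSURE.**  On the suffix fibre `{glue3 a w b : w}` (last three walk bits fixed to `b`), the (J3)-strategy with tables `F g` of
`r` dense forms `gateSum (ℓ g i)` per output IS a (J3)-strategy of the window game on `n` bits with
`r' = #(Fin r ⊕ (Fin 3 × Fin r) ⊕ Unit) = 4r + 1` forms per output — its own restricted forms, the three outside outputs' restricted forms
(through which the even outside triple is read), and `e₀` (the bit `w₀` used by E4's row `0`) — at the charge `c + |b|`. -/
theorem formsFibre_eq (hn : 1 ≤ n) (r : ℕ) (ℓ : Fin (0 + n + 3 + 1) → Fin r → Fin (0 + n + 3 + 1) → ZMod 3)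
    (F : Fin (0 + n + 3 + 1) → (Fin r → ZMod 3) → Bool) (c : ℕ) (a : Fin 0 → Bool) (b : Fin 3 → Bool) :
    ∃ (ℓ' : Fin (n + 1) → Fin (Fintype.card (Fin r ⊕ ((Fin 3 × Fin r) ⊕ Unit))) → Fin (n + 1) → ZMod 3)
      (F' : Fin (n + 1) → (Fin (Fintype.card (Fin r ⊕ ((Fin 3 × Fin r) ⊕ Unit))) → ZMod 3) → Bool),
      ∀ w : Fin n → Bool,
        ringWinU c (fun g u => F g (fun i => gateSum (ℓ g i) u)) (glue3 a w b) =
          ringWinU (c + wt b) (fun g w => F' g (fun i => gateSum (ℓ' g i) w)) w := by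
  -- restricted forms, one per (output of the big game, form index)
  choose L' κ hL using fun (g : Fin (0 + n + 3 + 1)) (i : Fin r) => gateSum_glue3_suffix hn (ℓ g i) a b
  set S := Fin r ⊕ ((Fin 3 × Fin r) ⊕ Unit) with hS
  set e : Fin (Fintype.card S) ≃ S := (Fintype.equivFin S).symm with he
  set y : Fin (0 + n + 3 + 1) → (Fin (0 + n + 3) → Bool) → Bool :=
    fun g u => F g (fun i => gateSum (ℓ g i) u) with hy
  set c' : ℕ := inCharge c a b with hc'
  set σ : ℕ := (3 - c' % 3) % 3 with hσ
  -- window / outside positions of the big game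
  set gin : Fin (n + 1) → Fin (0 + n + 3 + 1) := fun g' => ⟨0 + g'.val, by omega⟩ with hgin
  set gout : Fin 3 → Fin (0 + n + 3 + 1) := fun t => ⟨n + 1 + t.val, by omega⟩ with hgout
  set e0 : Fin (n + 1) → ZMod 3 := fun m => if m.val = 0 then 1 else 0 with he0
  -- the outside triple read through the outside outputs' restricted forms
  set Ψ : ℕ → (Fin 3 → Fin r → ZMod 3) → Bool := fun s V =>
    decide ((univ.filter fun t : Fin 3 =>
      F (gout t) (fun i => V t i + κ (gout t) i) = true ∧ gapChar n c a b (gout t).val s % 3 ≠ 0).card % 2 = 1)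
    with hΨ
  set Lsum : Fin (n + 1) → S → (Fin (n + 1) → ZMod 3) := fun g' =>
    Sum.elim (fun i => L' (gin g') i) (Sum.elim (fun ti => L' (gout ti.1) ti.2) (fun _ => e0)) with hLsum
  set Fsum : Fin (n + 1) → (S → ZMod 3) → Bool := fun g' V =>
    xor (if g'.val = 0 then
        xor (Ψ ((σ + 2) % 3) (fun t i => V (Sum.inr (Sum.inl (t, i)))))
          (Ψ σ (fun t i => V (Sum.inr (Sum.inl (t, i)))) && decide (V (Sum.inr (Sum.inr ())) = 0))
      else if g'.val = 1 then Ψ σ (fun t i => V (Sum.inr (Sum.inl (t, i)))) else false)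
      (F (gin g') (fun i => V (Sum.inl i) + κ (gin g') i)) with hFsum
  -- E4's two rows for the outside triple
  set Ytr : Fin (n + 1) → (Fin n → Bool) → Bool := fun g w =>
    if g.val = 0 then xor (outParity y c a b ((σ + 2) % 3) w) (outParity y c a b σ w && w ⟨0, hn⟩)
    else if g.val = 1 then outParity y c a b σ w else false with hYtr
  have hE4 : ∀ w, ringWinU c' Ytr w = outParity y c a b (wt w % 3) w :=
    fun w => ringWinU_tripleRows hn c' (outParity y c a b) (outParity_even c y a b) w
  -- the charge of the fibre
  have ha : wt a = 0 := by
    unfold wt; rw [Finset.univ_eq_empty, Finset.filter_empty, Finset.card_empty]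
  have hcharge : c' % 3 = (c + wt b) % 3 := by
    rw [hc']; unfold inCharge; rw [ha]; omega
  -- (a) the window outputs
  have hin : ∀ (g' : Fin (n + 1)) (w' : Fin n → Bool),
      inStrategy y a b g' w' = F (gin g') (fun i => gateSum (L' (gin g') i) w' + κ (gin g') i) := by
    intro g' w'
    have e1 : inStrategy y a b g' w' = F (gin g') (fun i => gateSum (ℓ (gin g') i) (glue3 a w' b)) := rfl
    rw [e1]
    congr 1
    funext i
    exact hL _ i w'
  -- (b) the outside triple
  have hP : ∀ (s : ℕ) (w' : Fin n → Bool), outParity y c a b s w' = Ψ s (fun t i => gateSum (L' (gout t) i) w') := by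
    intro s w'
    have hcard : (univ.filter fun g : Fin (0 + n + 3 + 1) => (g.val < 0 ∨ 0 + n < g.val) ∧
          y g (glue3 a w' b) = true ∧ gapChar n c a b g.val s % 3 ≠ 0).card =
        (univ.filter fun t : Fin 3 =>
          F (gout t) (fun i => gateSum (L' (gout t) i) w' + κ (gout t) i) = true ∧
            gapChar n c a b (gout t).val s % 3 ≠ 0).card := by
      refine Finset.card_bij (fun (g : Fin (0 + n + 3 + 1)) _ => (⟨g.val - (n + 1), by have := g.isLt; omega⟩ : Fin 3))
        ?_ ?_ ?_
      · intro g hg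
        rw [Finset.mem_filter] at hg
        obtain ⟨-, hrange, hyg, hgap⟩ := hg
        have hgn : n + 1 ≤ g.val := by omega
        have hgo : gout ⟨g.val - (n + 1), by have := g.isLt; omega⟩ = g := Fin.ext (by simp [hgout]; omega)
        rw [Finset.mem_filter]
        refine ⟨Finset.mem_univ _, ?_, ?_⟩
        · rw [hgo, ← hyg]; simp only [hy, hL]
        · rw [hgo]; exact hgap
      · intro g₁ hg₁ g₂ hg₂ h
        rw [Finset.mem_filter] at hg₁ hg₂
        have h' := congrArg Fin.val h
        apply Fin.ext
        simp only at h'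
        omega
      · intro t ht
        rw [Finset.mem_filter] at ht
        refine ⟨gout t, ?_, Fin.ext (by simp [hgout])⟩
        rw [Finset.mem_filter]
        refine ⟨Finset.mem_univ _, Or.inr (by simp [hgout]; omega), ?_, ht.2.2⟩
        rw [← ht.2.1]; simp only [hy, hL]
    unfold outParity outCount
    rw [hcard]
  -- (c) the bit `w₀`
  have h0 : ∀ (w' : Fin n → Bool) (inst : Decidable (gateSum e0 w' = 0)),
      @decide (gateSum e0 w' = 0) inst = w' ⟨0, hn⟩ := by
    intro w' inst; convert decide_gateSum_e0 hn w'
  refine ⟨fun g' j => Lsum g' (e j), fun g' v => Fsum g' (fun s => v (e.symm s)), fun w => ?_⟩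
  rw [ringWinU_glue3_eq_mixedWinU]
  unfold mixedWinU
  rw [← hE4 w, ← ringWinU_xor n c' Ytr (inStrategy y a b) w, ringWinU_charge_mod hcharge]
  congr 1
  funext g' w'
  simp only [hYtr, hFsum, hLsum, Equiv.apply_symm_apply, Sum.elim_inl, Sum.elim_inr, hin, hP, h0]

/-! ### §4 Every charge from the charges `≡ n + 2` -/

/-- **Counting over the eight suffix fibres.**  If every (J3)-strategy of the window game (`n` bits) with `4r + 1` forms per output wins
`≤ θ·2ⁿ` at the charges `≡ n + 2 (mod 3)`, then every (J3)-strategy with `r` forms per output on `n + 3` bits wins at EVERY charge `c` on at most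
`(6 + 2θ)·2ⁿ = ((3 + θ)/4)·2ⁿ⁺³` inputs: at least two of the eight suffixes `b` have `c + |b| ≡ n + 2` (`two_le_card_charge_class`). -/
theorem card_forms_le_of_topCharge (hn : 1 ≤ n) (r : ℕ) {θ : ℝ} (hθ : θ ≤ 1)
    (H : ∀ c₀ : ℕ, c₀ % 3 = (n + 2) % 3 →
      ∀ (ℓ' : Fin (n + 1) → Fin (Fintype.card (Fin r ⊕ ((Fin 3 × Fin r) ⊕ Unit))) → Fin (n + 1) → ZMod 3)
        (F' : Fin (n + 1) → (Fin (Fintype.card (Fin r ⊕ ((Fin 3 × Fin r) ⊕ Unit))) → ZMod 3) → Bool),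
        ((univ.filter fun w : Fin n → Bool =>
            ringWinU c₀ (fun g w => F' g (fun i => gateSum (ℓ' g i) w)) w = true).card : ℝ) ≤ θ * (2 : ℝ) ^ n)
    (ℓ : Fin (0 + n + 3 + 1) → Fin r → Fin (0 + n + 3 + 1) → ZMod 3) (c : ℕ)
    (F : Fin (0 + n + 3 + 1) → (Fin r → ZMod 3) → Bool) :
    ((univ.filter fun u : Fin (0 + n + 3) → Bool =>
        ringWinU c (fun g u => F g (fun i => gateSum (ℓ g i) u)) u = true).card : ℝ) ≤ (6 + 2 * θ) * (2 : ℝ) ^ n := by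
  rw [card_filter_eq_sum_glue3 (fun u : Fin (0 + n + 3) → Bool =>
    ringWinU c (fun g u => F g (fun i => gateSum (ℓ g i) u)) u = true)]
  push_cast
  have hfib : ∀ (a : Fin 0 → Bool) (b : Fin 3 → Bool),
      ((univ.filter fun w : Fin n → Bool =>
          ringWinU c (fun g u => F g (fun i => gateSum (ℓ g i) u)) (glue3 a w b) = true).card : ℝ) ≤
        (2 : ℝ) ^ n - (1 - θ) * (2 : ℝ) ^ n * (if (c + wt b) % 3 = (n + 2) % 3 then 1 else 0) := by
    intro a b
    obtain ⟨ℓ', F', hfibre⟩ := formsFibre_eq hn r ℓ F c a b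
    have heq : (univ.filter fun w : Fin n → Bool =>
        ringWinU c (fun g u => F g (fun i => gateSum (ℓ g i) u)) (glue3 a w b) = true) =
        univ.filter fun w : Fin n → Bool =>
          ringWinU (c + wt b) (fun g w => F' g (fun i => gateSum (ℓ' g i) w)) w = true :=
      Finset.filter_congr fun w _ => by rw [hfibre w]
    rw [heq]
    have h1 := Finset.card_le_univ (univ.filter fun w : Fin n → Bool =>
      ringWinU (c + wt b) (fun g w => F' g (fun i => gateSum (ℓ' g i) w)) w = true)
    rw [Fintype.card_fun, Fintype.card_bool, Fintype.card_fin] at h1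
    have h2 : ((univ.filter fun w : Fin n → Bool =>
        ringWinU (c + wt b) (fun g w => F' g (fun i => gateSum (ℓ' g i) w)) w = true).card : ℝ) ≤ (2 : ℝ) ^ n := by
      exact_mod_cast h1
    split_ifs with hb
    · have h := H (c + wt b) hb ℓ' F'
      linarith
    · linarith
  have hgood := two_le_card_charge_class 3 c (n + 2) (le_refl 3)
  have h2n : (0 : ℝ) ≤ (2 : ℝ) ^ n := by positivity
  calc ∑ a : Fin 0 → Bool, ∑ b : Fin 3 → Bool, ((univ.filter fun w : Fin n → Bool =>
          ringWinU c (fun g u => F g (fun i => gateSum (ℓ g i) u)) (glue3 a w b) = true).card : ℝ)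
      ≤ ∑ _a : Fin 0 → Bool, ∑ b : Fin 3 → Bool,
          ((2 : ℝ) ^ n - (1 - θ) * (2 : ℝ) ^ n * (if (c + wt b) % 3 = (n + 2) % 3 then 1 else 0)) :=
        Finset.sum_le_sum fun a _ => Finset.sum_le_sum fun b _ => hfib a b
    _ = ∑ b : Fin 3 → Bool,
          ((2 : ℝ) ^ n - (1 - θ) * (2 : ℝ) ^ n * (if (c + wt b) % 3 = (n + 2) % 3 then 1 else 0)) := by
        rw [Finset.sum_const, Finset.card_univ, Fintype.card_fun, Fintype.card_bool, Fintype.card_fin,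
          pow_zero, one_smul]
    _ = (2 : ℝ) ^ n * (2 : ℝ) ^ 3 -
          (1 - θ) * (2 : ℝ) ^ n *
            ((univ.filter fun b : Fin 3 → Bool => (c + wt b) % 3 = (n + 2) % 3).card : ℝ) := by
        rw [Finset.sum_sub_distrib, Finset.sum_const, Finset.card_univ, Fintype.card_fun, Fintype.card_bool,
          Fintype.card_fin, ← Finset.mul_sum, Finset.sum_boole, nsmul_eq_mul]
        push_cast
        ring
    _ ≤ (6 + 2 * θ) * (2 : ℝ) ^ n := by
        nlinarith [mul_nonneg (mul_nonneg (sub_nonneg.mpr hθ) h2n) (sub_nonneg.mpr hgood)]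

/-! ### §5 (J3) from the top charge, and the x-frame equivalence -/

/-- ★ **(J3) at the single charge `n + 2` (all large `n`, all `r`) implies (J3) at EVERY charge**, with `θ' = (3 + θ)/4`: peel the last three walk
bits (`card_forms_le_of_topCharge` with the hypothesis at `4r + 1` forms). -/
theorem perOutputFormsHardConst_of_topCharge
    (h : ∃ θ : ℝ, θ < 1 ∧ ∀ r : ℕ, ∃ n₀ : ℕ, ∀ n ≥ n₀,
      ∀ (ℓ : Fin (n + 1) → Fin r → Fin (n + 1) → ZMod 3) (F : Fin (n + 1) → (Fin r → ZMod 3) → Bool),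
        ((univ.filter fun u : Fin n → Bool =>
            ringWinU (n + 2) (fun g u => F g (fun i => gateSum (ℓ g i) u)) u = true).card : ℝ) ≤ θ * (2 : ℝ) ^ n) :
    PerOutputFormsHardConst := by
  obtain ⟨θ, hθ, hall⟩ := h
  refine ⟨(3 + θ) / 4, by linarith, fun r => ?_⟩
  obtain ⟨n₀, hn₀⟩ := hall (Fintype.card (Fin r ⊕ ((Fin 3 × Fin r) ⊕ Unit)))
  refine ⟨n₀ + 4, fun N hN ℓ c F => ?_⟩
  obtain ⟨n, rfl⟩ : ∃ n, N = 0 + n + 3 := ⟨N - 3, by omega⟩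
  have hn1 : 1 ≤ n := by omega
  have hnn : n₀ ≤ n := by omega
  have H : ∀ c₀ : ℕ, c₀ % 3 = (n + 2) % 3 →
      ∀ (ℓ' : Fin (n + 1) → Fin (Fintype.card (Fin r ⊕ ((Fin 3 × Fin r) ⊕ Unit))) → Fin (n + 1) → ZMod 3)
        (F' : Fin (n + 1) → (Fin (Fintype.card (Fin r ⊕ ((Fin 3 × Fin r) ⊕ Unit))) → ZMod 3) → Bool),
        ((univ.filter fun w : Fin n → Bool =>
            ringWinU c₀ (fun g w => F' g (fun i => gateSum (ℓ' g i) w)) w = true).card : ℝ) ≤ θ * (2 : ℝ) ^ n := by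
    intro c₀ hc₀ ℓ' F'
    have e : (univ.filter fun w : Fin n → Bool =>
        ringWinU c₀ (fun g w => F' g (fun i => gateSum (ℓ' g i) w)) w = true) =
        univ.filter fun w : Fin n → Bool =>
          ringWinU (n + 2) (fun g w => F' g (fun i => gateSum (ℓ' g i) w)) w = true :=
      Finset.filter_congr fun w _ => by rw [ringWinU_charge_mod hc₀]
    rw [e]
    exact hn₀ n hnn ℓ' F'
  have hmain := card_forms_le_of_topCharge hn1 r hθ.le H ℓ c F
  have e2 : (2 : ℝ) ^ (0 + n + 3) = 8 * (2 : ℝ) ^ n := by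
    rw [show 0 + n + 3 = n + 3 by omega, pow_add]; norm_num; ring
  rw [e2]
  linarith

/-- ★ **The x-frame form of (J3) gives the walk form at the top charge `n + 2`**: the x-strategy `tGuess x k ⊕ F k (linVal (ℓ k i) x)_i`
transports to the walk strategy `F g (gateSum (ℓ g i) u)_i` (`rel_iff_ringWinU`, `linVal ℓ (xOfU u) = gateSum ℓ u` by `rfl`), and
`#{u : WIN} ≤ #{x odd : WIN (uVec x)}` (`GradedSeeds38.card_filter_le_card_odd`). -/
theorem topCharge_of_xframe
    (h : ∃ θ : ℝ, θ < 1 ∧ ∀ r : ℕ, ∃ n₀ : ℕ, ∀ N ≥ n₀,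
      ∀ (ℓ : Fin N → Fin r → Fin N → ZMod 3) (F : Fin N → (Fin r → ZMod 3) → Bool),
        ((univ.filter fun x : Fin N → Bool =>
            OddZeros x ∧ RingHLF.Rel x (fun k => xor (tGuess x k) (F k (fun i => LinJunta39.linVal (ℓ k i) x)))).card : ℝ)
          ≤ θ * (2 : ℝ) ^ (N - 1)) :
    ∃ θ : ℝ, θ < 1 ∧ ∀ r : ℕ, ∃ n₀ : ℕ, ∀ n ≥ n₀,
      ∀ (ℓ : Fin (n + 1) → Fin r → Fin (n + 1) → ZMod 3) (F : Fin (n + 1) → (Fin r → ZMod 3) → Bool),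
        ((univ.filter fun u : Fin n → Bool =>
            ringWinU (n + 2) (fun g u => F g (fun i => gateSum (ℓ g i) u)) u = true).card : ℝ) ≤ θ * (2 : ℝ) ^ n := by
  obtain ⟨θ, hθ, hall⟩ := h
  refine ⟨θ, hθ, fun r => ?_⟩
  obtain ⟨n₀, hn₀⟩ := hall r
  refine ⟨max n₀ 2, fun n hn ℓ F => ?_⟩
  have hN : n₀ ≤ n + 1 := by have := le_max_left n₀ 2; omega
  have hn2 : 2 ≤ n := le_trans (le_max_right _ _) hn
  set z : (Fin (n + 1) → Bool) → (Fin (n + 1) → Bool) :=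
    fun x k => xor (tGuess x k) (F k (fun i => LinJunta39.linVal (ℓ k i) x)) with hz
  have hx := hn₀ (n + 1) hN ℓ F
  rw [Nat.add_sub_cancel] at hx
  set y : Fin (n + 1) → (Fin n → Bool) → Bool := fun g u => F g (fun i => gateSum (ℓ g i) u) with hy
  have hy' : (fun (g : Fin (n + 1)) (u : Fin n → Bool) => xor (z (xOfU u) g) (tGuess (xOfU u) g)) = y := by
    funext g u
    have e : (fun i => LinJunta39.linVal (ℓ g i) (xOfU u)) = fun i => gateSum (ℓ g i) u := rfl
    simp only [hz, hy, e]
    generalize tGuess (xOfU u) g = t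
    generalize F g (fun i => gateSum (ℓ g i) u) = d
    cases t <;> cases d <;> rfl
  have h1 := GradedSeeds38.card_filter_le_card_odd hn2 (fun u : Fin n → Bool => ringWinU (n + 2) y u = true)
  have h2 : (univ.filter fun x : Fin (n + 1) → Bool =>
        (univ.filter fun j : Fin (n + 1) => x j = false).card % 2 = 1 ∧ ringWinU (n + 2) y (uVec x) = true)
      ⊆ univ.filter fun x : Fin (n + 1) → Bool => OddZeros x ∧ RingHLF.Rel x (z x) := by
    intro x hx'
    rw [mem_filter] at hx' ⊢
    refine ⟨mem_univ _, hx'.2.1, ?_⟩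
    rw [rel_iff_ringWinU hn2 x hx'.2.1 z, hy']
    exact hx'.2.2
  have h3 := h1.trans (Finset.card_le_card h2)
  calc ((univ.filter fun u : Fin n → Bool => ringWinU (n + 2) y u = true).card : ℝ)
      ≤ ((univ.filter fun x : Fin (n + 1) → Bool => OddZeros x ∧ RingHLF.Rel x (z x)).card : ℝ) := by
        exact_mod_cast h3
    _ ≤ θ * (2 : ℝ) ^ n := hx

/-- ★ **(J3) gives its x-frame form** (instantiate the charge `c = n + 2` and transport through the chart: `#{x odd : WIN (uVec x)} ≤ #{u : WIN u}`,
`card_odd_filter_le`). -/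
theorem xframe_of_perOutputFormsHardConst (h : PerOutputFormsHardConst) :
    ∃ θ : ℝ, θ < 1 ∧ ∀ r : ℕ, ∃ n₀ : ℕ, ∀ N ≥ n₀,
      ∀ (ℓ : Fin N → Fin r → Fin N → ZMod 3) (F : Fin N → (Fin r → ZMod 3) → Bool),
        ((univ.filter fun x : Fin N → Bool =>
            OddZeros x ∧ RingHLF.Rel x (fun k => xor (tGuess x k) (F k (fun i => LinJunta39.linVal (ℓ k i) x)))).card : ℝ)
          ≤ θ * (2 : ℝ) ^ (N - 1) := by
  obtain ⟨θ, hθ, hall⟩ := h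
  refine ⟨θ, hθ, fun r => ?_⟩
  obtain ⟨n₀, hn₀⟩ := hall r
  refine ⟨n₀ + 3, fun N hN ℓ F => ?_⟩
  obtain ⟨n, rfl⟩ : ∃ n, N = n + 1 := ⟨N - 1, by omega⟩
  have hn2 : 2 ≤ n := by omega
  have hnn : n₀ ≤ n := by omega
  set z : (Fin (n + 1) → Bool) → (Fin (n + 1) → Bool) :=
    fun x k => xor (tGuess x k) (F k (fun i => LinJunta39.linVal (ℓ k i) x)) with hz
  set y : Fin (n + 1) → (Fin n → Bool) → Bool := fun g u => F g (fun i => gateSum (ℓ g i) u) with hy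
  have hy' : (fun (g : Fin (n + 1)) (u : Fin n → Bool) => xor (z (xOfU u) g) (tGuess (xOfU u) g)) = y := by
    funext g u
    have e : (fun i => LinJunta39.linVal (ℓ g i) (xOfU u)) = fun i => gateSum (ℓ g i) u := rfl
    simp only [hz, hy, e]
    generalize tGuess (xOfU u) g = t
    generalize F g (fun i => gateSum (ℓ g i) u) = d
    cases t <;> cases d <;> rfl
  have hx := hn₀ n hnn ℓ (n + 2) F
  rw [Nat.add_sub_cancel]
  have heq : (univ.filter fun x : Fin (n + 1) → Bool => OddZeros x ∧ RingHLF.Rel x (z x)) =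
      univ.filter fun x : Fin (n + 1) → Bool =>
        (univ.filter fun j : Fin (n + 1) => x j = false).card % 2 = 1 ∧ ringWinU (n + 2) y (uVec x) = true := by
    refine Finset.filter_congr fun x _ => ?_
    constructor
    · rintro ⟨hodd, hrel⟩
      refine ⟨hodd, ?_⟩
      rw [rel_iff_ringWinU hn2 x hodd z, hy'] at hrel
      exact hrel
    · rintro ⟨hodd, hwin⟩
      refine ⟨hodd, ?_⟩
      rw [rel_iff_ringWinU hn2 x hodd z, hy']
      exact hwin
  have h2 := card_odd_filter_le hn2 (fun u : Fin n → Bool => ringWinU (n + 2) y u = true)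
  rw [heq]
  calc ((univ.filter fun x : Fin (n + 1) → Bool =>
          (univ.filter fun j : Fin (n + 1) => x j = false).card % 2 = 1 ∧ ringWinU (n + 2) y (uVec x) = true).card : ℝ)
      ≤ ((univ.filter fun u : Fin n → Bool => ringWinU (n + 2) y u = true).card : ℝ) := by exact_mod_cast h2
    _ ≤ θ * (2 : ℝ) ^ n := hx

/-- ★ **(J3) from its x-frame form.** -/
theorem perOutputFormsHardConst_of_xframe
    (h : ∃ θ : ℝ, θ < 1 ∧ ∀ r : ℕ, ∃ n₀ : ℕ, ∀ N ≥ n₀,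
      ∀ (ℓ : Fin N → Fin r → Fin N → ZMod 3) (F : Fin N → (Fin r → ZMod 3) → Bool),
        ((univ.filter fun x : Fin N → Bool =>
            OddZeros x ∧ RingHLF.Rel x (fun k => xor (tGuess x k) (F k (fun i => LinJunta39.linVal (ℓ k i) x)))).card : ℝ)
          ≤ θ * (2 : ℝ) ^ (N - 1)) :
    PerOutputFormsHardConst :=
  perOutputFormsHardConst_of_topCharge (topCharge_of_xframe h)

/-- ★★ **(J3) IS FRAME- AND CHARGE-INDEPENDENT**: `BlockFibre37.PerOutputFormsHardConst` (walk frame, every charge `c`) holds iff its x-frame form on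
the odd class does — for every `r`, for all large `N`, every strategy `x ↦ (tGuess x k ⊕ F k (⟨ℓ_{k,i}, x⟩)_{i<r})_k` solves the `p = 3` ring relation
on `≤ θ·2^{N−1}` odd inputs (the format of `GradedSeeds38.perOutputForms_structured_slackX'` / `perOutputForms_dichotomy` with the structure
forgotten).  Constants: x-frame `θ` ⟹ walk `(3 + θ)/4`; walk `θ` ⟹ x-frame `θ`. -/
theorem perOutputFormsHardConst_iff_xframe :
    PerOutputFormsHardConst ↔
      ∃ θ : ℝ, θ < 1 ∧ ∀ r : ℕ, ∃ n₀ : ℕ, ∀ N ≥ n₀,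
        ∀ (ℓ : Fin N → Fin r → Fin N → ZMod 3) (F : Fin N → (Fin r → ZMod 3) → Bool),
          ((univ.filter fun x : Fin N → Bool =>
              OddZeros x ∧ RingHLF.Rel x (fun k => xor (tGuess x k) (F k (fun i => LinJunta39.linVal (ℓ k i) x)))).card : ℝ)
            ≤ θ * (2 : ℝ) ^ (N - 1) :=
  ⟨xframe_of_perOutputFormsHardConst, perOutputFormsHardConst_of_xframe⟩
end BlockFibre37

end Summit.QuantumAdvantage.AdviceFreeQNC0

end
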